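import Summits.NavierStokesRegularity.NavierStokesRegularity.Theorems.SqueezeCycleExtremalBiaxialitySubcriticalOfLiouville
import Summits.NavierStokesRegularity.NavierStokesRegularity.Theorems.SqueezeCycleExtremalElementExistsRegularity
import Summits.NavierStokesRegularity.NavierStokesRegularity.Theorems.SqueezeCycleExtremalElementExistsRescale
import Literature.Analysis.FluidPDE.LerayGaugeStrainSpectrum
import Literature.Analysis.FluidPDE.TypeIAncientMild
import Literature.Analysis.FluidPDE.EnstrophyGronwall
import HarnessLib

/-!
# Route `SqueezeCycle`, crux `ExtremalBiaxialitySubcritical` — the class-uniform Leray-gauge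
# strain bound (line `quarter-bootstrap-pinning`, stub `stub_gaugeStrainBound`)

Helper file for item `stmt-NavierStokesRegularity-11609`
(`Summit.NavierStokesRegularity.NavierStokesRegularity.Theses.SqueezeCycle.ExtremalBiaxialitySubcritical`).

Main result `stub_gaugeStrainBound`: for every Type-I constant `C` there is `K = K(C) > 0` such
that every element `v'` of the route's Type-I model class `𝒦_C` (joint smoothness, `div v' = 0`,
the KNSS-mild Oseen identity, the Type-I rate, the two scaled-energy bounds) satisfies
`∑ᵢⱼ Sᵢⱼ(t,x)² ≤ (K/(−t))²` at every `t < 0` and every `x`, where `S = ½(M + Mᵀ)` and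
`M = stdMatrix ∇v'(t,x)` is the velocity-gradient matrix in the standard basis.

Proof.
* The first four clauses of `𝒦_C` are the tree's `IsTypeIAncientMild C v'`
  (`isTypeIAncientMild_of_squeezeClass`); the scaled-energy clause is not used.
* KNSS 2009, Prop. 4.1 / (4.10) with `k = 1` on the window `[−2, −1/2)` gives a constant
  `K₀ = K₀(C)` with `‖∇w(−1)(y)‖ ≤ K₀` for **every** field `w` of the class
  (`exists_norm_iteratedFDeriv_le_of_typeI`).
* The Navier–Stokes zoom `w = c • stPull c² c 0 x v'`, `c = √(−t)`, stays in the class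
  (`isTypeIAncientMild_zoom`) and `∇w(−1)(0) = c² ∇v'(t)(x)` (`fderiv_zoom`), whence the gauge
  bound `(−t) ‖∇v'(t)(x)‖ ≤ K₀` at every `t < 0`, `x` (`exists_gauge_norm_fderiv_le_of_typeI`).
* Frobenius bookkeeping on `3 × 3` matrices: `|S|²_F ≤ |M|²_F` (`sum_sq_symmPart_le_sum_sq`),
  `|M|²_F = |∇v'|²_F` (`frobeniusNormSq_eq_sum_sq_stdMatrix`) and `|∇v'|²_F ≤ 3 ‖∇v'‖²_op`
  (`frobeniusNormSq_le_three_mul`); with `K := 2|K₀| + 1`, `3 K₀² ≤ K²`.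

Source: G. Koch, N. Nadirashvili, G. Seregin, V. Šverák, *Liouville theorems for the
Navier–Stokes equations and applications*, Acta Math. 203 (2009), Prop. 4.1, (4.6), (4.10) and
the scaling (1.2) (arXiv:0709.3599v1, pp. 2, 8). Not here: any use of the energy clause, any
statement about higher derivatives.
-/

noncomputable section

open MeasureTheory Set Filter Topology
open scoped RealInnerProductSpace Matrix

namespace Summit.NavierStokesRegularity.NavierStokesRegularity.Theorems

open Literature.Analysis Literature.Analysis.FluidPDE

/-! ## Matrix bookkeeping -/

/-- **The symmetric part does not increase the Frobenius norm** (real `3 × 3` matrices):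
`∑ᵢⱼ (½(M + Mᵀ))ᵢⱼ² ≤ ∑ᵢⱼ Mᵢⱼ²`; the difference is `½ ∑_{i<j} (Mᵢⱼ − Mⱼᵢ)²`, the squared
Frobenius norm of the antisymmetric part. [folklore] -/
theorem sum_sq_symmPart_le_sum_sq (M : Matrix (Fin 3) (Fin 3) ℝ) :
    (∑ i, ∑ j, (((1 / 2 : ℝ) • (M + Mᵀ)) i j) ^ 2) ≤ ∑ i, ∑ j, (M i j) ^ 2 := by
  simp only [Fin.sum_univ_three, Matrix.smul_apply, Matrix.add_apply, Matrix.transpose_apply,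
    smul_eq_mul]
  nlinarith [sq_nonneg (M 0 1 - M 1 0), sq_nonneg (M 0 2 - M 2 0), sq_nonneg (M 1 2 - M 2 1)]

/-- **Strain Frobenius norm versus operator norm of the gradient**: for `A : ℝ³ →L[ℝ] ℝ³`
with matrix `M = stdMatrix A` in the standard basis, `∑ᵢⱼ (½(M + Mᵀ))ᵢⱼ² ≤ 3 ‖A‖²`
(`|S|²_F ≤ |M|²_F = |A|²_F ≤ 3 ‖A‖²_op`: three columns, each of norm at most `‖A‖`). [folklore] -/
theorem sum_sq_symmPart_stdMatrix_le
    (A : EuclideanSpace ℝ (Fin 3) →L[ℝ] EuclideanSpace ℝ (Fin 3)) :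
    (∑ i, ∑ j, (((1 / 2 : ℝ) •
      (stdMatrix (A : EuclideanSpace ℝ (Fin 3) →ₗ[ℝ] EuclideanSpace ℝ (Fin 3)) +
        (stdMatrix (A : EuclideanSpace ℝ (Fin 3) →ₗ[ℝ] EuclideanSpace ℝ (Fin 3)))ᵀ)) i j) ^ 2) ≤
      3 * ‖A‖ ^ 2 :=
  calc (∑ i, ∑ j, (((1 / 2 : ℝ) •
      (stdMatrix (A : EuclideanSpace ℝ (Fin 3) →ₗ[ℝ] EuclideanSpace ℝ (Fin 3)) +
        (stdMatrix (A : EuclideanSpace ℝ (Fin 3) →ₗ[ℝ] EuclideanSpace ℝ (Fin 3)))ᵀ)) i j) ^ 2)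
        ≤ ∑ i, ∑ j,
          (stdMatrix (A : EuclideanSpace ℝ (Fin 3) →ₗ[ℝ] EuclideanSpace ℝ (Fin 3)) i j) ^ 2 :=
      sum_sq_symmPart_le_sum_sq _
    _ = frobeniusNormSq A := (frobeniusNormSq_eq_sum_sq_stdMatrix A).symm
    _ ≤ 3 * ‖A‖ ^ 2 := frobeniusNormSq_le_three_mul A

/-! ## The class-uniform gauge gradient bound -/

/-- **Class-uniform Leray-gauge gradient bound**: there is `K₀ = K₀(C)` with
`(−t) ‖∇v(t)(x)‖ ≤ K₀` for every Type-I KNSS-mild ancient field `v` with constant `C`, every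
`t < 0` and every `x`. KNSS 2009, Prop. 4.1 / (4.10) with `k = 1` on the window `[−2, −1/2)`
(`exists_norm_iteratedFDeriv_le_of_typeI`) bounds `‖∇w(−1)(0)‖` uniformly over the class; it is
applied to the zoom `w(s, y) = c v(c² s, x + c y)`, `c = √(−t)` (`isTypeIAncientMild_zoom`,
the scaling (1.2)), whose gradient at `(−1, 0)` is `c² ∇v(t)(x) = (−t) ∇v(t)(x)` (`fderiv_zoom`).
[cite: KochNadirashviliSereginSverak2009, Prop. 4.1 (4.6)/(4.10) with k = 1 and §1 (1.2) (arXiv:0709.3599v1 pp. 2, 8)] -/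
theorem exists_gauge_norm_fderiv_le_of_typeI (C : ℝ) :
    ∃ K₀ : ℝ, ∀ ⦃v : ℝ → EuclideanSpace ℝ (Fin 3) → EuclideanSpace ℝ (Fin 3)⦄,
      IsTypeIAncientMild C v → ∀ t < 0, ∀ x, (-t) * ‖fderiv ℝ (v t) x‖ ≤ K₀ := by
  obtain ⟨K₀, hK₀⟩ := exists_norm_iteratedFDeriv_le_of_typeI C 1 (a := -3) (b := -(1 / 2))
    (δ := 1) (by norm_num) (by norm_num) one_pos
  refine ⟨K₀, fun v hv t ht x => ?_⟩
  set c : ℝ := Real.sqrt (-t) with hcdef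
  have hc : 0 < c := Real.sqrt_pos.2 (neg_pos.2 ht)
  have hc2 : c ^ 2 = -t := Real.sq_sqrt (neg_pos.2 ht).le
  -- the zoomed field is in the class
  have hw : IsTypeIAncientMild C (c • stPull (c ^ 2) c 0 x v) := isTypeIAncientMild_zoom hv hc x
  have hd : Differentiable ℝ (v (c ^ 2 * (-1))) := by
    rw [hc2, show -t * (-1) = t by ring]
    exact (hv.contDiff_slice ht).differentiable (by simp)
  -- KNSS (4.10), `k = 1`, at `(-1, 0)` for the zoomed field
  have h := hK₀ hw.continuousOn_uncurry (fun s hs => hw.isWeaklyDivFree hs)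
    (fun s r hsr hr y => hw.mild_eq_heatExtension hsr hr y) hw.hasTypeITimeDecay (-1)
    ⟨by norm_num, by norm_num⟩ 0
  rw [norm_iteratedFDeriv_one, fderiv_zoom x v hd 0, norm_smul, smul_zero, add_zero, hc2,
    show -t * (-1) = t by ring, Real.norm_of_nonneg (neg_pos.2 ht).le] at h
  exact h

/-! ## The stub -/

/-- **stub_gaugeStrainBound** (line `quarter-bootstrap-pinning` of crux
`ExtremalBiaxialitySubcritical`) — the class-uniform Leray-gauge strain bound: for every `C`
there is `K = K(C) > 0` such that every element `v'` of the Type-I model class `𝒦_C` has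
Frobenius strain `∑ᵢⱼ Sᵢⱼ(t,x)² ≤ (K/(−t))²` at every `t < 0`, `x`, where `S = ½(M + Mᵀ)`,
`M = stdMatrix ∇v'(t,x)`. Proof: the first four class clauses are `IsTypeIAncientMild C v'`
(`isTypeIAncientMild_of_squeezeClass`); the gauge gradient bound `(−t)‖∇v'(t)(x)‖ ≤ K₀(C)`
(`exists_gauge_norm_fderiv_le_of_typeI`: KNSS 2009 Prop. 4.1/(4.10), `k = 1`, transported by the
Navier–Stokes zoom); `|S|²_F ≤ 3 ‖∇v'‖²_op` (`sum_sq_symmPart_stdMatrix_le`); `K := 2|K₀| + 1`.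
The energy clause of the class is not needed. [cite: KochNadirashviliSereginSverak2009, Prop. 4.1 (4.6)/(4.10) with k = 1 (arXiv:0709.3599v1 p. 8)] -/
theorem stub_gaugeStrainBound :
    ∀ C : ℝ, ∃ K : ℝ, 0 < K ∧ ∀ (v' : ℝ → EuclideanSpace ℝ (Fin 3) → EuclideanSpace ℝ (Fin 3)), ContDiffOn ℝ (⊤ : ℕ∞) (Function.uncurry v') (Set.Iio 0 ×ˢ Set.univ) ∧ (∀ t < 0, Literature.Analysis.FluidPDE.VectorCalculus.IsDivFree (v' t)) ∧ (∀ s t : ℝ, s < t → t < 0 → ∀ x, v' t x = Literature.Analysis.FluidPDE.heatFlow (v' s) (t-s) x - ∫ τ in Set.Ioo s t, ∫ y, ((-(inner ℝ (x-y) (v' τ y) / (2*(t-τ)) * Literature.Analysis.UnboundedOperators.heatKernel (t-τ) (x-y))) • v' τ y + (∫ σ in Set.Ioi (t-τ), Literature.Analysis.UnboundedOperators.heatKernel σ (x-y) / (4*σ^2)) • (inner ℝ (x-y) (v' τ y) • v' τ y + inner ℝ (v' τ y) (v' τ y) • (x-y) + inner ℝ (x-y) (v' τ y) • v' τ y) -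 ((∫ σ in Set.Ioi (t-τ), Literature.Analysis.UnboundedOperators.heatKernel σ (x-y) / (8*σ^3)) * (inner ℝ (x-y) (v' τ y) * inner ℝ (x-y) (v' τ y))) • (x-y))) ∧ Literature.Analysis.FluidPDE.HasTypeITimeDecay C v' ∧ (∀ (x₀ : EuclideanSpace ℝ (Fin 3)) (t₀ r : ℝ), t₀ ≤ 0 → 0 < r → (∀ t, t₀ - r^2 < t → t < t₀ → r⁻¹ * ∫ x in Metric.ball x₀ r, ‖v' t x‖^2 ≤ C) ∧ r⁻¹ * ∫ t in Set.Ioo (t₀ - r^2) t₀, ∫ x in Metric.ball x₀ r, ‖fderiv ℝ (v' t) x‖^2 ≤ C) → ∀ t < 0, ∀ x, (∑ i, ∑ j, (((1 / 2 : ℝ) • (Literature.Analysis.FluidPDE.stdMatrix (fderiv ℝ (v' t) x : EuclideanSpace ℝ (Fin 3) →ₗ[ℝ] EuclideanSpace ℝ (Fin 3)) + (Literature.Analysis.FluidPDE.stdMatrix (fderiv ℝ (v' t) x : EuclideanSpace ℝ (Fin 3) →ₗ[ℝ] EuclideanSpace ℝ (Fin 3)))ᵀ)) i j) ^ 2) ≤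 (K / (-t)) ^ 2 := by
  intro C
  obtain ⟨K₀, hK₀⟩ := exists_gauge_norm_fderiv_le_of_typeI C
  refine ⟨2 * |K₀| + 1, by positivity, ?_⟩
  rintro v' ⟨h1, h2, h3, h4, -⟩ t ht x
  -- membership in the tree's Type-I KNSS-mild class
  have hv : IsTypeIAncientMild C v' := isTypeIAncientMild_of_squeezeClass h1 h2 h3 h4
  have ht' : 0 < -t := neg_pos.2 ht
  -- the gauge gradient bound at `(t, x)`
  have hA : (-t) * ‖fderiv ℝ (v' t) x‖ ≤ |K₀| := (hK₀ hv t ht x).trans (le_abs_self K₀)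
  have hA0 : 0 ≤ (-t) * ‖fderiv ℝ (v' t) x‖ := mul_nonneg ht'.le (norm_nonneg _)
  have hsq : ((-t) * ‖fderiv ℝ (v' t) x‖) ^ 2 ≤ |K₀| ^ 2 := pow_le_pow_left₀ hA0 hA 2
  -- `|S|² ≤ 3 ‖∇v'‖² ≤ 3 K₀² / (-t)² ≤ (K / (-t))²`
  refine (sum_sq_symmPart_stdMatrix_le (fderiv ℝ (v' t) x)).trans ?_
  rw [div_pow, le_div_iff₀ (pow_pos ht' 2)]
  calc 3 * ‖fderiv ℝ (v' t) x‖ ^ 2 * (-t) ^ 2 = 3 * ((-t) * ‖fderiv ℝ (v' t) x‖) ^ 2 := by ring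
    _ ≤ 3 * |K₀| ^ 2 := by linarith
    _ ≤ (2 * |K₀| + 1) ^ 2 := by nlinarith [abs_nonneg K₀]

end Summit.NavierStokesRegularity.NavierStokesRegularity.Theorems

end
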